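import Summits.CriticalPhenomena.Ising3DConformalLimit.Theses.MirrorHoelderCompactness

/-!
# CriticalPhenomena / Ising3DConformalLimit — route `MirrorHoelderCompactness`, assembly

Settles item `stmt-CriticalPhenomena-6160` (assembly of route
`route-CriticalPhenomena-MirrorHoelderCompactness`, rank 1):

`TwoPointDoubling → SeparableHoelder → NonSeparableModulus → PointwiseLimit → CompactnessGlue →
LimitConstruction → LimitsAreConformal → Ising3DConformalLimit`.

Pure logic over the structure predicates of
`Literature/Probability/LatticeModels/ScalingLimit3D.lean`. `CompactnessGlue` applied to the three
lattice inputs (D) `TwoPointDoubling`, (SH) `SeparableHoelder`, (NS) `NonSeparableModulus` gives the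
compactness milestone (uniform bounds + asymptotic equicontinuity + two-point lower bound, the text
of `UniformRegularity`); `LimitConstruction` applied to it and to (PL) `PointwiseLimit` produces
`ρ, Δ, S` with `ρ > 0` on `(0,1]`, `0 < Δ`, the pointwise scaling limit, the normalisation
`S = 0` off `NonCoincident`, non-degeneracy of the two-point function, translation invariance and
scale covariance; `LimitsAreConformal` upgrades these to rotation invariance, inversion covariance
and `HasNontrivialU4 S`. Packing `IsEuclideanInvariant S := ⟨translation, rotation⟩` and
`IsMoebiusCovariant Δ S := ⟨Euclidean, scale, inversion⟩` yields the 6-tuple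
`CritIsing3DConformalLimit` (= the conjunct `Ising3DConformalLimit`). This is the same term as the
route's deciding theorem
`Summit.CriticalPhenomena.Ising3DConformalLimit.Theses.MirrorHoelderCompactness.closes`; no named
facts are used, the theorem is unconditional bookkeeping.

What is NOT here: any of the seven hypotheses (items `stmt-CriticalPhenomena-6150` D, `-6151` SH,
`-6152` NS, `-6153` PL, `-6158` CompactnessGlue, `-6159` LimitConstruction, `-6154` LAC), which
carry all the mathematics of the route.
-/

namespace Summit.CriticalPhenomena.Ising3DConformalLimit.Theorems

open Summit.CriticalPhenomena.Ising3DConformalLimit.Theses.MirrorHoelderCompactness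

/-- Settles `stmt-CriticalPhenomena-6160` (exact signature of
`Theses.MirrorHoelderCompactness.Assembly`): the assembly
`TwoPointDoubling → SeparableHoelder → NonSeparableModulus → PointwiseLimit → CompactnessGlue →
LimitConstruction → LimitsAreConformal → Ising3DConformalLimit` of route
`MirrorHoelderCompactness`. Proof: unfold; `LimitConstruction (CompactnessGlue D SH NS) PL` gives
`ρ, Δ, S` with positivity of `ρ` on `(0,1]`, `0 < Δ`, the pointwise limit, normalisation,
non-degeneracy, translation invariance and scale covariance; `LimitsAreConformal` applied to these
gives rotation invariance, inversion covariance and `HasNontrivialU4 S`; the witness for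
`Ising3DConformalLimit` is `⟨ρ, Δ, S, …⟩` with `IsMoebiusCovariant Δ S` assembled from
`⟨⟨translation, rotation⟩, scale, inversion⟩`. [folklore] -/
theorem mirrorHoelderCompactness_assembly_proof :
    Summit.CriticalPhenomena.Ising3DConformalLimit.Theses.MirrorHoelderCompactness.Assembly := by
  unfold Assembly
  intro hD hSH hNS hPL hCG hLC hLAC
  obtain ⟨ρ, Δ, S, hρ, hΔ, hlim, hnorm, hnd, htr, hsc⟩ := hLC (hCG hD hSH hNS) hPL
  obtain ⟨hrot, hinv, hU4⟩ := hLAC ρ Δ S hρ hlim hnorm hnd htr hsc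
  exact ⟨ρ, Δ, S, hρ, hΔ, hlim, hnd, ⟨⟨htr, hrot⟩, hsc, hinv⟩, hU4⟩

end Summit.CriticalPhenomena.Ising3DConformalLimit.Theorems
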